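import Literature.MathematicalPhysics.QuantumFieldTheory.Balaban1983to89.B1Ineq225DerivRegularRegion
import Literature.MathematicalPhysics.QuantumFieldTheory.Balaban1983to89.B1Ineq224RegularTorus

/-!
# `Balaban1983to89.B1Ineq224RegularRegion` — [Balaban1982Higgs1] Prop. 2.1 (2.24) p. 610, THE HÖLDER CLAUSE WITH ITS DECAY FACTOR, FOR
# BIG-BLOCK REGIONS `Ω ⊂ T_ε` UNDER `R₀` AT EVERY (2.23)-REGULAR FIELD ON THE (Higgs)₂,₃ CARRIER = [Balaban1983RegularityDecay] Theorem (1.9)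
# for regions, carrier instance: the two regimes of p. 578 — the walk expansion with the HÖLDER PROBE
# `Φ(w) = |U(A(Γ))(D^ε_A w)(⟨x′, μ⟩) − (D^ε_A w)(⟨x, μ⟩)|` when `|x − x′| ≤ L^K` (this seat's general-probe chain
# `B1Ineq225DerivRegularRegion.chain_region_of_inputs_probe` with `X₀ = {x, x′}`) and «a simple consequence of the corresponding inequality for the
# derivative only» beyond (the derivative member `B1Ineq225DerivRegularRegion.norm_covDeriv_propagatorK_region_reg_decay`)

statement-level skeleton of published theorems with citation tags; proofs where landed; nothing here is a claim about the Yang–Mills mass gap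

PDF held: `paper:balaban1982-cmp85-higgs23-i` p. 610 [PDF 8]; `paper:balaban1983-cmp89-regularity-decay` pp. 572–573, 577–579 [PDF 2–3, 7–9] (text
layer re-read by this seat).

CITATION HEADER (lean-in-tree rule).  T. Bałaban, *(Higgs)₂,₃ quantum fields in a finite volume. I. A lower bound*, Commun. Math. Phys. **85**
(1982) 603–626 [Balaban1982Higgs1] (Prop. 2.1 (2.23), (2.24) p. 610) and T. Bałaban, *Regularity and decay of lattice Green's functions*, Commun.
Math. Phys. **89** (1983) 571–597 [Balaban1983RegularityDecay] (Theorem (1.9) p. 573; p. 578 «hence we can assume |x′ − x| ≤ 1»; (2.16) p. 577; (2.18)–(2.22) pp. 578–579).  Quotation docfix (self-audit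
after ref-4 gen 45 QUOTE-AUDIT-B1-p35, filed gen 13): the WHAT IS PRINTED block quotes only printed sentences; no declaration changed.  Cell `lit-balaban` (HOME
`run/shared/lean/pub/lit-balaban/`), Phase-2 proof seat **p35** gen 12 (unit `lit-balaban-p35`); SKELETON rows **B1.Prop2.1** / **B1.Eq2.24**
(REGIONS of `T_ε` under `R₀`, concrete carrier) and **B4.Thm1.9(regions, carrier instance)**.  USED BY NAME, never restated: this seat's
`B1Ineq225DerivRegularRegion` (`chain_region_of_inputs_probe`, `cube_deriv_sup`, `norm_covDeriv_tail_le`, `exists_le_of_geometric`,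
`covDeriv_add'`, `covDeriv_zero'`, `covDeriv_sum'`, `norm_covDeriv_propagatorK_region_reg_decay`), `B1Ineq225RegularRegion`
(`abs_acT_sub_le_of_reg_on`, `lpT_two_le_of_blockK`, `bOp_of_good`, `Gloc_of_good`, `rS_le_real`, `blockPiece`, `sum_blockPiece`),
`B1TorusCubeLpInput.cube_inputs_lp`, `B1Lemma21RegularRegion.sNorm_bOp_le_of_bad`, gen 10's `B1TorusCubeHolderInput.cube_input_holder`,
`B1TorusCubeHolderProbe.norm_probe_hsmul_le`, `B1TorusChainTransport.{IsTChain, hol, norm_hol_apply}`, `covDeriv_hsmul_eq_zero_off`,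
`eight_rS_le`, r14's `tdist_blockIter_le_real`, `sum_exp_neg_tdist_le`.

WHAT IS PRINTED.  [B1] p. 610: *«|x − x′|^{−α}|U(A(Γ_{x,x′}))(D^η_{A,μ}G_k(Ω, A)f)(x′) − (D^η_{A,μ}G_k(Ω, A)f)(x)| ≤ c₀ exp(−δ₀ dist({x, x′}, supp f))‖f‖_∞ (2.24)
for x, x′ ∈ Ω and satisfying the condition dist({x, x′}, Ω^c) ≥ R₀»*;
[B4] p. 578: *«If |x′ − x| > 1, then this inequality is a simple consequence of the corresponding inequality for the
derivative only, hence we can assume |x′ − x| ≤ 1.»*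

WHAT THIS FILE PROVES (kernel-checked, zero `sorry`; theorems only, no definition, no `Prop` fact).
* §1 **`cube_input_holder_reg_on`** — gen 11's Hölder cube input (2.16) at `Ã_j` with the (2.23) hypothesis read on the sites of `□_j` only.
* §2 private bookkeeping (`one_le_tdist_of_ne`, `gammaT_le`: `γ_T ≤ C_near(t/n)^α(L^Kε)`).
* §3 **`norm_holder_propagatorK_region_reg_decay`** — PROP. 2.1 (2.24) FOR BIG-BLOCK REGIONS UNDER `R₀` AT EVERY (2.23)-REGULAR `A`, `g` in a
  `K`-block: for `d ≥ 1`, `L ≥ 2`, `a, m² > 0`, `N`, `(e, q)`, `ε₀`, `(c, β)`: a cube-size threshold `K₀min` chosen BEFORE `α`, and for every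
  `0 ≤ α < 1` a constant `c₀ > 0` and per `K₀ ≥ K₀min` a threshold `e₁ > 0` such that on every torus of the carrier (`K₀ ∣ M`), every level,
  every big-block union `Ω`, every `A`, `0 < e_K ≤ e₁` with (2.23) on `Ω`, every direction `μ`, sites `x′ ≠ x` with
  `{|y − x| ≤ 2rS + 2M(d+1) + 1}, {|y − x′| ≤ …} ⊂ Ω` and nearest-neighbour chain `Γ` with `|Γ| ≤ d|x − x′|`, every `g` in a `K`-block with
  `‖g‖_∞ ≤ M′` vanishing within `D` of `x` and of `x′`:
  `(|x − x′|/L^K)^{−α}·‖U(A(Γ))(D^ε_AG^ε_K(Ω,A)1_Ωg)(⟨x′,μ⟩) − (D^ε_AG^ε_K(Ω,A)1_Ωg)(⟨x,μ⟩)‖ ≤ c₀(L^Kε)·e^{−D/(2K₀L^K)}·M′`.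
* §4 **`norm_holder_propagatorK_region_reg_decay_sum`** — the same for ARBITRARY `g` (summed over the `K`-blocks), rate `e^{−D/(4K₀L^K)}`, `c₀(K₀)`.
HONEST SCOPE.  Operator form (not the kernel form); `Ω` a big-block union; `R₀` in site form around `x` and `x′`; (2.23) used on `Ω` only;
(2.26) for regions remains a separate row.  Unit `lit-balaban-p35` gen 12 (literature-prover-lit-balaban-p35-g12-0).
-/

open scoped BigOperators

noncomputable section

namespace Literature.MathematicalPhysics.QuantumFieldTheory.Balaban1983to89.B1Ineq224RegularRegion

open Literature.MathematicalPhysics.QuantumFieldTheory.Balaban1983to89.HiggsLattice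
open Literature.MathematicalPhysics.QuantumFieldTheory.Balaban1983to89.HiggsAveraging
open Literature.MathematicalPhysics.QuantumFieldTheory.Balaban1983to89.HiggsCovariance
open Literature.MathematicalPhysics.QuantumFieldTheory.Balaban1983to89.HiggsCovariancePos
open Literature.MathematicalPhysics.QuantumFieldTheory.Balaban1983to89.HiggsCovarianceCont (sNorm sNorm_nonneg sNorm_smul)
open Literature.MathematicalPhysics.QuantumFieldTheory.Balaban1983to89.B1TorusCubeCover
open Literature.MathematicalPhysics.QuantumFieldTheory.Balaban1983to89.B1TorusCubeLocality26 (rS cubeVec rS_succ_lt_half)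
open Literature.MathematicalPhysics.QuantumFieldTheory.Balaban1983to89.B1TorusCubeChart (dd dd_succ castD toT M2 predL_succ)
open Literature.MathematicalPhysics.QuantumFieldTheory.Balaban1983to89.B1TorusCubeBoxOp (acT)
open Literature.MathematicalPhysics.QuantumFieldTheory.Balaban1983to89.B1TorusCubeHolderInput (cube_input_holder)
open Literature.MathematicalPhysics.QuantumFieldTheory.Balaban1983to89.B1TorusCubeHolderProbe (norm_probe_hsmul_le)
open Literature.MathematicalPhysics.QuantumFieldTheory.Balaban1983to89.B1TorusChainTransport (IsTChain hol norm_hol_apply)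
open Literature.MathematicalPhysics.QuantumFieldTheory.Balaban1983to89.B4GaugeCovariance (pathEnd)
open Literature.MathematicalPhysics.QuantumFieldTheory.Balaban1983to89.B4Lemma22ReduceZero (Box)
open Literature.MathematicalPhysics.QuantumFieldTheory.Balaban1983to89.B4Lower18Regular (e1)
open Literature.MathematicalPhysics.QuantumFieldTheory.Balaban1983to89.B4Lemma22EtaBox (vol vol_pos)
open Literature.MathematicalPhysics.QuantumFieldTheory.Balaban1983to89.B4PartitionUnity22 (hprof D1 D2 D1_nonneg D2_nonneg contDiff_hprof
  hasCompactSupport_hprof)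
open Literature.MathematicalPhysics.QuantumFieldTheory.Balaban1983to89.B1TorusRegionCubes
open Literature.MathematicalPhysics.QuantumFieldTheory.Balaban1983to89.B1TorusRegionHSizes (IsBigBlockUnion blockSat_of_isBigBlockUnion)
open Literature.MathematicalPhysics.QuantumFieldTheory.Balaban1983to89.B1TorusRegionRop
open Literature.MathematicalPhysics.QuantumFieldTheory.Balaban1983to89.B1TorusLabelWalk
open Literature.MathematicalPhysics.QuantumFieldTheory.Balaban1983to89.B1Lemma21RegularRegion (sNorm_bOp_le_of_bad)
open Literature.MathematicalPhysics.QuantumFieldTheory.Balaban1983to89.B1TorusCubeLpInput (lpT lpT_def lpT_nonneg cube_inputs_lp)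
open Literature.MathematicalPhysics.QuantumFieldTheory.Balaban1983to89.B1Ineq225RegionChain
open Literature.MathematicalPhysics.QuantumFieldTheory.Balaban1983to89.B1Ineq225RegularRegion
open Literature.MathematicalPhysics.QuantumFieldTheory.Balaban1983to89.B1Ineq225DerivRegularRegion
open Literature.MathematicalPhysics.QuantumFieldTheory.Balaban1983to89.B1Ineq225DecayBackgroundTorus (tdist_le_of_near eight_rS_le)
open Literature.MathematicalPhysics.QuantumFieldTheory.Balaban1983to89.B1Ineq225DerivDecayBackgroundTorus (covDeriv_hsmul_eq_zero_off)
open Literature.MathematicalPhysics.QuantumFieldTheory.Balaban1983to89.B1Ineq234LevelZero (tdist_triangle_real tdist_shift_le_one)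
open Literature.MathematicalPhysics.QuantumFieldTheory.Balaban1983to89.B1Ineq234Concrete (tdist_blockIter_le_real)
open Literature.MathematicalPhysics.QuantumFieldTheory.Balaban1983to89.B2Eq230CondShiftBound (sum_exp_neg_tdist_le)
open Literature.MathematicalPhysics.QuantumFieldTheory.Balaban1983to89.B4Sect5Proof (latticeConst latticeConst_nonneg)

variable {P : HiggsLattice.Params} {N : ℕ}

/-! ## §1 The Hölder cube input (2.16) under (2.23) on the cube -/

section CubeInput

/-- **THE HÖLDER CUBE INPUT (2.16) AT `Ã_j` UNDER (2.23) ON THE SITES OF `□_j`** (gen 11's `cube_input_holder_reg`, hypothesis localised): a constant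
`C_H > 0` and per cube size `K₀ ≥ 8` a threshold `e₃ > 0` such that … for every `A`, `0 < e_K ≤ e₃`, every cube `□_j` with (2.23) on its sites,
with `u_j = G_K(□_j, Ã_j)(h_jψ)`: `‖U(Ã_j(Γ))(D^ε_{Ã_j}u_j)(⟨x′,μ⟩) − (D^ε_{Ã_j}u_j)(⟨x,μ⟩)‖ ≤ C_H(|x − x′|/L^K)^α(L^Kε)‖ψ‖_∞` for
`x, x+e_μ, x′, x′+e_μ, Γ ⊂ □_j`, `x′ ≠ x`, `|Γ| ≤ d|x − x′|`. [cite: Balaban1982Higgs1, Prop. 2.1 (2.23) p.610]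
[cite: Balaban1983RegularityDecay, Lemma 2.2 (2.16) pp.577–578] -/
theorem cube_input_holder_reg_on (C : ChargeData N) (d0 ℓ0 : ℕ) (hℓ0 : 1 ≤ ℓ0) {a : ℝ} (ha : 0 < a) {msq : ℝ} (hmsq : 0 < msq)
    (m2plus : ℝ) (creg β : ℝ) (hcreg : 0 ≤ creg) (hβ : 0 < β) {α : ℝ} (hα0 : 0 ≤ α) (hα1 : α < 1) :
    ∃ CH : ℝ, 0 < CH ∧ ∀ K₀ : ℕ, 8 ≤ K₀ → ∃ e₃ : ℝ, 0 < e₃ ∧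
      ∀ (P : HiggsLattice.Params), dd P = d0 → P.L - 1 = ℓ0 → ∀ {K : ℕ}, 1 ≤ K → K ≤ P.K → K₀ ∣ P.M →
      (∀ μ, 3 * half P K K₀ ≤ P.sitesPerDir 0 μ) → msq * P.mesh K ^ 2 ≤ m2plus →
      ∀ (A : HiggsLattice.VecField P 0) {ec : ℝ}, 0 < ec → ec ≤ e₃ →
      ∀ (j : Lab P K K₀), (∀ x ∈ cube K K₀ j, ∀ μ ν : Fin P.d,
          P.mesh K * |C.e| / ec * |A ⟨x.shift μ, ν⟩ - A ⟨x, ν⟩| ≤ creg * ec ^ (β - 1) / (P.L : ℝ) ^ K) →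
      ∀ (ψ : HiggsLattice.ScalarField P 0 N) (μ : Fin P.d) (x x' : HiggsLattice.Site P 0)
        (l : List (HiggsLattice.Site P 0)),
        x ∈ cube K K₀ j → x.shift μ ∈ cube K K₀ j → x' ∈ cube K K₀ j → x'.shift μ ∈ cube K K₀ j → x' ≠ x →
        IsTChain x l → pathEnd x l = x' → (∀ y ∈ l, y ∈ cube K K₀ j) →
        (l.length : ℝ) ≤ (P.d : ℝ) * HiggsLattice.Site.tdist x x' →
        ‖hol C (cubeVec K K₀ j A) x l
              (covDeriv C (cubeVec K K₀ j A) (propagatorK C (cube K K₀ j) (cubeVec K K₀ j A) msq a K (hTor K K₀ j • ψ)) ⟨x', μ⟩)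
            - covDeriv C (cubeVec K K₀ j A) (propagatorK C (cube K K₀ j) (cubeVec K K₀ j A) msq a K (hTor K K₀ j • ψ)) ⟨x, μ⟩‖
          ≤ CH * ((HiggsLattice.Site.tdist x x' : ℝ) / (P.L : ℝ) ^ K) ^ α * P.mesh K * ‖ψ‖ := by
  obtain ⟨CH, hCH, hhi⟩ := cube_input_holder C d0 ℓ0 hℓ0 a a m2plus ha hα0 hα1
  refine ⟨CH, hCH, fun K₀ hK₀8 => ?_⟩
  obtain ⟨e₃, he₃, hhthr⟩ := hhi creg β hcreg hβ K₀ hK₀8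
  refine ⟨e₃, he₃, ?_⟩
  intro P hPd hPL K hK1 hK hK₀M hN3 hcap A ec hec hle j hreg ψ μ x x' l h1 h2 h3 h4 hne hch hend h5 hlen
  have hK₀' : 1 ≤ K₀ := le_trans (by norm_num) hK₀8
  exact hhthr P hPd hPL K hK1 hK hK₀M hN3 a msq le_rfl le_rfl hmsq hcap j A ec hec hle
    (abs_acT_sub_le_of_reg_on hK hK₀M hK₀' C j A hec hreg) ψ μ x x' l h1 h2 h3 h4 hne hch hend h5 hlen

end CubeInput

/-! ## §2 Bookkeeping -/

section Helpers

/-- distinct torus sites are at (1.3)-distance at least one lattice unit. [cite: Balaban1982Higgs1, (1.3) p.604] -/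
private theorem one_le_tdist_of_ne {k : ℕ} {x x' : HiggsLattice.Site P k} (h : x' ≠ x) : 1 ≤ HiggsLattice.Site.tdist x x' := by
  obtain ⟨μ, hμ⟩ : ∃ μ, x' μ ≠ x μ := by
    by_contra hc
    push Not at hc
    exact h (funext hc)
  unfold HiggsLattice.Site.tdist
  refine le_trans ?_ (Finset.le_sup (f := fun ν : Fin P.d => min (x ν - x' ν).val (x' ν - x ν).val) (Finset.mem_univ μ))
  refine le_min ?_ ?_
  · exact Nat.one_le_iff_ne_zero.2 fun h0 => hμ (sub_eq_zero.1 ((ZMod.val_eq_zero _).1 h0)).symm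
  · exact Nat.one_le_iff_ne_zero.2 fun h0 => hμ (sub_eq_zero.1 ((ZMod.val_eq_zero _).1 h0))

/-- the near-regime bookkeeping: `γ_T ≤ C_near·(t/n)^α·(L^Kε)` for `1 ≤ t ≤ n`, `|Γ| ≤ dt`, `K₀ ≥ 8`. [folklore] -/
private theorem gammaT_le {Pd K₀ : ℕ} (hK₀8 : 8 ≤ K₀) {D₁ D₂ CH Cδ Cγ t n m0 ℓ α : ℝ} (hD₁ : 0 ≤ D₁) (hD₂ : 0 ≤ D₂)
    (hCδ : 0 ≤ Cδ) (hCγ : 0 ≤ Cγ) (hn : 0 < n) (hm0 : 0 < m0) (ht1 : 1 ≤ t) (htn : t ≤ n) (hℓ0 : 0 ≤ ℓ)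
    (hℓ : ℓ ≤ (Pd : ℝ) * t) (hα1 : α < 1) :
    CH * (t / n) ^ α * (n * m0) + (Pd : ℝ) * (D₁ + D₂) / (K₀ : ℝ) * ((2 * ℓ + 2) / n) * (Cδ * (n * m0))
        + (D₁ ^ 2 + D₂) / (K₀ : ℝ) ^ 2 * ((Pd : ℝ) * ℓ / (n ^ 2 * m0)) * (Cγ * (n * m0) ^ 2)
      ≤ (CH + (Pd : ℝ) * (D₁ + D₂) / 8 * (2 * (Pd : ℝ) + 2) * Cδ + (D₁ ^ 2 + D₂) / 64 * (Pd : ℝ) ^ 2 * Cγ) * (t / n) ^ α * (n * m0) := by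
  have hK₀r : (8 : ℝ) ≤ K₀ := by exact_mod_cast hK₀8
  have ht0 : 0 < t := lt_of_lt_of_le one_pos ht1
  have hq0 : 0 < t / n := div_pos ht0 hn
  have hq1 : t / n ≤ 1 := (div_le_one hn).2 htn
  set w : ℝ := (t / n) ^ α with hw
  have hqw : t / n ≤ w := by
    have h := Real.rpow_le_rpow_of_exponent_ge hq0 hq1 hα1.le
    rwa [Real.rpow_one] at h
  have hw0 : 0 ≤ w := Real.rpow_nonneg hq0.le α
  have hPd : (0 : ℝ) ≤ Pd := Nat.cast_nonneg _
  have h2a : (Pd : ℝ) * (D₁ + D₂) / (K₀ : ℝ) ≤ (Pd : ℝ) * (D₁ + D₂) / 8 :=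
    div_le_div_of_nonneg_left (by positivity) (by norm_num) hK₀r
  have h2b : (2 * ℓ + 2) / n ≤ (2 * (Pd : ℝ) + 2) * w := by
    have h1 : 2 * ℓ + 2 ≤ (2 * (Pd : ℝ) + 2) * t := by nlinarith
    calc (2 * ℓ + 2) / n ≤ (2 * (Pd : ℝ) + 2) * t / n := div_le_div_of_nonneg_right h1 hn.le
      _ = (2 * (Pd : ℝ) + 2) * (t / n) := by ring
      _ ≤ (2 * (Pd : ℝ) + 2) * w := mul_le_mul_of_nonneg_left hqw (by positivity)
  have h2 : (Pd : ℝ) * (D₁ + D₂) / (K₀ : ℝ) * ((2 * ℓ + 2) / n) * (Cδ * (n * m0))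
      ≤ (Pd : ℝ) * (D₁ + D₂) / 8 * ((2 * (Pd : ℝ) + 2) * w) * (Cδ * (n * m0)) := by
    have h2c : 0 ≤ (2 * ℓ + 2) / n := by positivity
    gcongr
  have h3a : (D₁ ^ 2 + D₂) / (K₀ : ℝ) ^ 2 ≤ (D₁ ^ 2 + D₂) / 64 :=
    div_le_div_of_nonneg_left (by positivity) (by norm_num) (by nlinarith)
  have h3e : (D₁ ^ 2 + D₂) / (K₀ : ℝ) ^ 2 * ((Pd : ℝ) * ℓ / (n ^ 2 * m0)) * (Cγ * (n * m0) ^ 2)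
      = (D₁ ^ 2 + D₂) / (K₀ : ℝ) ^ 2 * ((Pd : ℝ) * ℓ) * (Cγ * m0) := by
    field_simp
  have h3b : (Pd : ℝ) * ℓ ≤ (Pd : ℝ) ^ 2 * w * n := by
    calc (Pd : ℝ) * ℓ ≤ (Pd : ℝ) * ((Pd : ℝ) * t) := mul_le_mul_of_nonneg_left hℓ hPd
      _ = (Pd : ℝ) ^ 2 * (t / n) * n := by field_simp
      _ ≤ (Pd : ℝ) ^ 2 * w * n := by gcongr
  have h3 : (D₁ ^ 2 + D₂) / (K₀ : ℝ) ^ 2 * ((Pd : ℝ) * ℓ / (n ^ 2 * m0)) * (Cγ * (n * m0) ^ 2)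
      ≤ (D₁ ^ 2 + D₂) / 64 * ((Pd : ℝ) ^ 2 * w * n) * (Cγ * m0) := by
    rw [h3e]
    have : 0 ≤ (Pd : ℝ) * ℓ := by positivity
    gcongr
  calc CH * (t / n) ^ α * (n * m0) + (Pd : ℝ) * (D₁ + D₂) / (K₀ : ℝ) * ((2 * ℓ + 2) / n) * (Cδ * (n * m0))
        + (D₁ ^ 2 + D₂) / (K₀ : ℝ) ^ 2 * ((Pd : ℝ) * ℓ / (n ^ 2 * m0)) * (Cγ * (n * m0) ^ 2)
      ≤ CH * w * (n * m0) + (Pd : ℝ) * (D₁ + D₂) / 8 * ((2 * (Pd : ℝ) + 2) * w) * (Cδ * (n * m0))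
        + (D₁ ^ 2 + D₂) / 64 * ((Pd : ℝ) ^ 2 * w * n) * (Cγ * m0) := by rw [hw]; linarith
    _ = (CH + (Pd : ℝ) * (D₁ + D₂) / 8 * (2 * (Pd : ℝ) + 2) * Cδ + (D₁ ^ 2 + D₂) / 64 * (Pd : ℝ) ^ 2 * Cγ) * w * (n * m0) := by
        ring

end Helpers


/-! ## §3 Prop. 2.1 (2.24) for big-block regions under `R₀` at every (2.23)-regular field: the two regimes of p. 578 -/

section Main

set_option maxHeartbeats 1600000 in
/-- **PROP. 2.1 (2.24), HÖLDER CLAUSE WITH ITS DECAY FACTOR, FOR BIG-BLOCK REGIONS `Ω ⊂ T_ε` UNDER `R₀`, AT EVERY (2.23)-REGULAR VECTOR FIELD —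
B4's THEOREM (1.9) FOR REGIONS ON THE CARRIER**, `g` supported in a `K`-block.  For `d ≥ 1`, `L ≥ 2`, `a > 0`, `m² > 0`, `N`, `(e, q)`, a mesh
cap `ε₀` and a regularity pair `c ≥ 0`, `β > 0`: a cube-size threshold `K₀min` chosen BEFORE `α`, and for every `0 ≤ α < 1` a constant `c₀ > 0`
and per cube size `K₀ ≥ K₀min` a threshold `e₁ > 0` such that on EVERY torus of the carrier with `K₀ ∣ M`, at every level `1 ≤ K ≤ K_P` with
`3·L^KK₀ ≤ |T_ε|_μ`, `L^Kε ≤ ε₀`, for every big-block union `Ω`, EVERY vector field `A` and `0 < e_K ≤ e₁` with (2.23) on `Ω`, every direction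
`μ`, sites `x′ ≠ x` with `{|y − x| ≤ 2rS + 2M(d+1) + 1} ⊂ Ω`, `{|y − x′| ≤ 2rS + 2M(d+1) + 1} ⊂ Ω` and nearest-neighbour chain `Γ` from `x` to
`x′` with `|Γ| ≤ d|x − x′|`, every `g` supported in a `K`-block with `‖g‖_∞ ≤ M′` vanishing at the sites within distance `< D` of `x` and of
`x′`: `(|x − x′|/L^K)^{−α}·‖U(A(Γ))(D^ε_AG^ε_K(Ω, A)1_Ωg)(⟨x′,μ⟩) − (D^ε_AG^ε_K(Ω, A)1_Ωg)(⟨x,μ⟩)‖ ≤ c₀(L^Kε)·exp(−D/(2K₀L^K))·M′`.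
Proof: `|x − x′| ≤ L^K` by `chain_region_of_inputs_probe` with the Hölder probe at `X₀ = {x, x′}` (letters as in the value member, probe bound
`γ_T = C_near(|x−x′|/L^K)^α(L^Kε)` from `norm_probe_hsmul_le` fed by `cube_deriv_sup` and `cube_input_holder_reg_on`, room `K₀ ≥ 8d + 24`);
`|x − x′| > L^K` from `norm_covDeriv_propagatorK_region_reg_decay` at both bonds.
[cite: Balaban1982Higgs1, Prop. 2.1 (2.23)–(2.24) p.610] [cite: Balaban1983RegularityDecay, Theorem (1.9) p.573; p.578; (2.22) p.579] -/
theorem norm_holder_propagatorK_region_reg_decay (d L : ℕ) (hd : 1 ≤ d) (hL : 2 ≤ L) {a : ℝ} (ha : 0 < a) {msq : ℝ} (hmsq : 0 < msq)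
    (N : ℕ) (C : ChargeData N) (ε₀ : ℝ) (creg β : ℝ) (hcreg : 0 ≤ creg) (hβ : 0 < β) :
    ∃ K₀min : ℕ, ∀ {α : ℝ}, 0 ≤ α → α < 1 → ∃ c₀ : ℝ, 0 < c₀ ∧ ∀ K₀ : ℕ, K₀min ≤ K₀ → ∃ e₁ : ℝ, 0 < e₁ ∧
      ∀ (P : HiggsLattice.Params), P.d = d → P.L = L → K₀ ∣ P.M →
      ∀ {K : ℕ}, 1 ≤ K → K ≤ P.K → (∀ μ, 3 * half P K K₀ ≤ P.sitesPerDir 0 μ) → P.mesh K ≤ ε₀ →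
      ∀ (Ω : Finset (HiggsLattice.Site P 0)), IsBigBlockUnion K K₀ Ω →
      ∀ (A : HiggsLattice.VecField P 0) {ec : ℝ}, 0 < ec → ec ≤ e₁ →
      (∀ z ∈ Ω, ∀ μ ν : Fin P.d,
          P.mesh K * |C.e| / ec * |A ⟨z.shift μ, ν⟩ - A ⟨z, ν⟩| ≤ creg * ec ^ (β - 1) / (P.L : ℝ) ^ K) →
      ∀ (μ : Fin P.d) (x x' : HiggsLattice.Site P 0), x' ≠ x →
        (∀ y, HiggsLattice.Site.tdist x y ≤ 2 * rS P K K₀ + 2 * half P K K₀ * (P.d + 1) + 1 → y ∈ Ω) →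
        (∀ y, HiggsLattice.Site.tdist x' y ≤ 2 * rS P K K₀ + 2 * half P K K₀ * (P.d + 1) + 1 → y ∈ Ω) →
        ∀ (l : List (HiggsLattice.Site P 0)), IsTChain x l → pathEnd x l = x' →
          (l.length : ℝ) ≤ (P.d : ℝ) * HiggsLattice.Site.tdist x x' →
        ∀ (y₀ : HiggsLattice.Site P 0) (g : HiggsLattice.ScalarField P 0 N) (M D : ℝ),
          (∀ y, blockIter K y ≠ blockIter K y₀ → g y = 0) → (∀ y, ‖g y‖ ≤ M) → 0 ≤ D →
          (∀ z, g z ≠ 0 → D ≤ (HiggsLattice.Site.tdist x z : ℝ)) → (∀ z, g z ≠ 0 → D ≤ (HiggsLattice.Site.tdist x' z : ℝ)) →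
            (((HiggsLattice.Site.tdist x x' : ℝ) / (P.L : ℝ) ^ K)⁻¹) ^ α *
                ‖hol C A x l (covDeriv C A (propagatorK C Ω A msq a K (chi Ω • g)) ⟨x', μ⟩)
                  - covDeriv C A (propagatorK C Ω A msq a K (chi Ω • g)) ⟨x, μ⟩‖
              ≤ c₀ * P.mesh K * Real.exp (-(D / (2 * K₀ * (P.L : ℝ) ^ K))) * M := by
  have hℓ0 : 1 ≤ L - 1 := by omega
  have hp₁ : (((d - 1 : ℕ)) : ℝ) + 1 < 2 * d := by
    rw [Nat.cast_sub hd, Nat.cast_one]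
    have : (1 : ℝ) ≤ d := by exact_mod_cast hd
    linarith
  obtain ⟨Cγ, Cβ, hCγ, hCβ, hcube⟩ := cube_inputs_lp C (d - 1) (L - 1) hℓ0 a a (msq * ε₀ ^ 2) ha hp₁
  obtain ⟨Cγ', Cδ, CT, hCγ', hCδ, hCT, hderiv⟩ := cube_deriv_sup C (d - 1) (L - 1) hℓ0 ha hmsq (msq * ε₀ ^ 2) creg β hcreg hβ
  obtain ⟨c₉, hc₉, K₉, hfar⟩ := norm_covDeriv_propagatorK_region_reg_decay d L hd hL ha hmsq N C ε₀ creg β hcreg hβ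
  -- the boundary-piece constant of Lemma 2.1 (depends on `d, L, a` only)
  have hLr : (1 : ℝ) < L := by exact_mod_cast (show 1 < L by omega)
  set γ₀ : ℝ := min 2 (a * (1 - (((L : ℕ) : ℝ) ^ 2)⁻¹) / 4) with hγ₀
  have hγ₀pos : 0 < γ₀ := by
    have h1 : (((L : ℕ) : ℝ) ^ 2)⁻¹ < 1 := inv_lt_one_of_one_lt₀ (by nlinarith)
    exact lt_min (by norm_num) (by nlinarith [mul_pos ha (show (0 : ℝ) < 1 - (((L : ℕ) : ℝ) ^ 2)⁻¹ by linarith)])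
  set Cb : ℝ := ((((d - 1 : ℕ)) : ℝ) + 1) * (D1 hprof + D2 hprof) * (γ₀⁻¹ + 2 * Real.sqrt (d * γ₀⁻¹) + a * γ₀⁻¹) with hCb
  have hD1 := D1_nonneg contDiff_hprof hasCompactSupport_hprof
  have hD2 := D2_nonneg contDiff_hprof hasCompactSupport_hprof
  have hCb0 : 0 ≤ Cb := by
    have := inv_nonneg.2 hγ₀pos.le
    have := Real.sqrt_nonneg (d * γ₀⁻¹)
    positivity
  set Cm : ℝ := max Cβ Cb with hCm
  have hCm0 : 0 < Cm := lt_of_lt_of_le hCβ (le_max_left _ _)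
  -- the cube size is fixed BEFORE `α`
  refine ⟨max (max K₉ 8) (max ⌈(3 : ℝ) ^ d * Cm * Real.exp 1⌉₊ (8 * d + 24)), fun {α} hα0 hα1 => ?_⟩
  obtain ⟨CH, hCH, hhol⟩ := cube_input_holder_reg_on C (d - 1) (L - 1) hℓ0 ha hmsq (msq * ε₀ ^ 2) creg β hcreg hβ hα0 hα1
  set Cnear : ℝ := CH + (d : ℝ) * (D1 hprof + D2 hprof) / 8 * (2 * (d : ℝ) + 2) * Cδ + (D1 hprof ^ 2 + D2 hprof) / 64 * (d : ℝ) ^ 2 * Cγ'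
    with hCnear
  have hCnear0 : 0 < Cnear := by positivity
  refine ⟨4 * 2 ^ d * Cnear * Real.exp (3 / 2) + 2 * c₉, by positivity, fun K₀ hK₀ => ?_⟩
  have hK₀9 : K₉ ≤ K₀ := le_trans (le_trans (le_max_left _ _) (le_max_left _ _)) hK₀
  have hK₀8 : 8 ≤ K₀ := le_trans (le_trans (le_max_right _ _) (le_max_left _ _)) hK₀
  have hK₀r : (0 : ℝ) < K₀ := by exact_mod_cast lt_of_lt_of_le (by norm_num) hK₀8
  have hK₀C : (3 : ℝ) ^ d * Cm * Real.exp 1 ≤ K₀ :=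
    (Nat.le_ceil _).trans (by exact_mod_cast le_trans (le_trans (le_max_left _ _) (le_max_right _ _)) hK₀)
  have hK₀d : 8 * d + 24 ≤ K₀ := le_trans (le_trans (le_max_right _ _) (le_max_right _ _)) hK₀
  obtain ⟨e₁, he₁, hcubeK⟩ := hcube creg β hcreg hβ K₀ hK₀8
  obtain ⟨e₃, he₃, hderK⟩ := hderiv K₀ hK₀8
  obtain ⟨e₄, he₄, hholK⟩ := hhol K₀ hK₀8
  obtain ⟨e₉, he₉, hfarK⟩ := hfar K₀ hK₀9
  -- the smallness of `e_K` for Lemma 2.1 at the boundary pieces: `d²·c·e_K^β ≤ 1/3`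
  set es : ℝ := ((3 * ((d : ℝ) ^ 2 * creg + 1))⁻¹) ^ β⁻¹ with hes
  have hin : 0 < (3 * ((d : ℝ) ^ 2 * creg + 1))⁻¹ := by positivity
  have hes0 : 0 < es := Real.rpow_pos_of_pos hin _
  refine ⟨min (min (min e₁ es) e₃) (min e₄ e₉), lt_min (lt_min (lt_min he₁ hes0) he₃) (lt_min he₄ he₉), ?_⟩
  intro P hPd hPL hK₀M K hK1 hK hN3 hε Ω hΩ A ec hec hle' hreg μ x x' hne hRx hRx' l hch hend hlen y₀ g M D hg hgM hD0 hDx hDx'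
  have hle : ec ≤ min e₁ es := hle'.trans ((min_le_left _ _).trans (min_le_left _ _))
  have hle3 : ec ≤ e₃ := hle'.trans ((min_le_left _ _).trans (min_le_right _ _))
  have hle4 : ec ≤ e₄ := hle'.trans ((min_le_right _ _).trans (min_le_left _ _))
  have hle9 : ec ≤ e₉ := hle'.trans ((min_le_right _ _).trans (min_le_right _ _))
  -- the far-regime tool: the derivative member at a bond whose source carries `R₀ + 1` and the distance `D`
  have hfar' := fun (z : HiggsLattice.Site P 0)
      (hRz : ∀ y, HiggsLattice.Site.tdist z y ≤ 2 * rS P K K₀ + 2 * half P K K₀ * (P.d + 1) + 1 → y ∈ Ω)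
      (hDz : ∀ w, g w ≠ 0 → D ≤ (HiggsLattice.Site.tdist z w : ℝ)) =>
    hfarK P hPd hPL hK₀M hK1 hK hN3 hε Ω hΩ A hec hle9 hreg z μ hRz y₀ g M D hg hgM hD0 hDz
  subst hPd
  have hdd : dd P = P.d - 1 := rfl
  have hPL1 : P.L - 1 = L - 1 := by rw [hPL]
  have hL1 : 1 < P.L := by rw [hPL]; omega
  have hL1r : (1 : ℝ) < P.L := by exact_mod_cast hL1
  have hak : 0 ≤ B1.aSeq a P.L K := (B1.aSeq_pos ha hL1r hK1).le
  have hK₀' : 1 ≤ K₀ := le_trans (by norm_num) hK₀8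
  have hmesh : 0 < P.mesh K := P.mesh_pos K
  have hmesh0 : 0 < P.mesh 0 := P.mesh_pos 0
  have hcap : msq * P.mesh K ^ 2 ≤ msq * ε₀ ^ 2 := mul_le_mul_of_nonneg_left (pow_le_pow_left₀ hmesh.le hε 2) hmsq.le
  have hM0 : 0 ≤ M := (norm_nonneg _).trans (hgM x)
  have hgn : ‖g‖ ≤ M := (pi_norm_le_iff_of_nonneg hM0).2 hgM
  have hn0 : (0 : ℝ) < (P.L : ℝ) ^ K := by positivity
  set t : ℝ := (HiggsLattice.Site.tdist x x' : ℝ) with ht_def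
  have ht1 : 1 ≤ t := by rw [ht_def]; exact_mod_cast one_le_tdist_of_ne hne
  have ht0 : 0 < t := lt_of_lt_of_le one_pos ht1
  have hq0 : 0 < t / (P.L : ℝ) ^ K := div_pos ht0 hn0
  set Q : ℝ := ‖hol C A x l (covDeriv C A (propagatorK C Ω A msq a K (chi Ω • g)) ⟨x', μ⟩)
    - covDeriv C A (propagatorK C Ω A msq a K (chi Ω • g)) ⟨x, μ⟩‖ with hQ_def
  have hQ0 : 0 ≤ Q := norm_nonneg _
  have hE0 := (Real.exp_pos (-(D / (2 * K₀ * (P.L : ℝ) ^ K)))).le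
  by_cases hnt : HiggsLattice.Site.tdist x x' ≤ P.L ^ K
  · -- the regime `|x − x′| ≤ L^K`: the walk for the Hölder probe
    have htn : t ≤ (P.L : ℝ) ^ K := by rw [ht_def]; exact_mod_cast hnt
    have hroom : 4 * (rS P K K₀ + P.d * P.L ^ K + 2) ≤ 3 * half P K K₀ := by
      have h8 := eight_rS_le (P := P) (K := K) (K₀ := K₀)
      have hn1 : 1 ≤ P.L ^ K := Nat.one_le_pow K P.L P.hL
      have hh : P.L ^ K * (8 * P.d + 24) ≤ P.L ^ K * K₀ := Nat.mul_le_mul_left _ hK₀d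
      unfold half at h8 ⊢
      have e1 : P.L ^ K * (8 * P.d + 24) = 8 * (P.d * P.L ^ K) + 24 * P.L ^ K := by ring
      rw [e1] at hh
      generalize P.L ^ K * K₀ = h at h8 hh ⊢
      generalize P.d * P.L ^ K = nd at hh ⊢
      omega
    -- the letter constant and its smallness
    set βK : ℝ := Cm / K₀ with hβK
    have hβK0 : 0 ≤ βK := div_nonneg hCm0.le hK₀r.le
    have hCβK : Cβ / K₀ ≤ βK := div_le_div_of_nonneg_right (le_max_left _ _) hK₀r.le
    have hCbK : Cb / K₀ ≤ βK := div_le_div_of_nonneg_right (le_max_right _ _) hK₀r.le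
    have hDβ : (3 : ℝ) ^ P.d * βK ≤ Real.exp (-1) := by
      rw [hβK, mul_div_assoc', div_le_iff₀ hK₀r]
      have h1 : Real.exp (-1) * Real.exp 1 = 1 := by rw [← Real.exp_add]; norm_num
      have h2 : (3 : ℝ) ^ P.d * Cm = (3 : ℝ) ^ P.d * Cm * Real.exp 1 * Real.exp (-1) := by
        rw [mul_assoc ((3 : ℝ) ^ P.d * Cm), mul_comm (Real.exp 1), h1, mul_one]
      rw [h2]
      exact mul_le_mul_of_nonneg_right hK₀C (Real.exp_pos _).le |>.trans_eq (mul_comm _ _)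
    have h23 : (2 : ℝ) ^ P.d * βK < 1 := by
      have h1 : (2 : ℝ) ^ P.d ≤ 3 ^ P.d := pow_le_pow_left₀ (by norm_num) (by norm_num) _
      have h2 : Real.exp (-1) < 1 := Real.exp_lt_one_iff.2 (by norm_num)
      nlinarith [mul_le_mul_of_nonneg_right h1 hβK0]
    -- the cube inputs at the interior cubes
    have hcj : ∀ j : Lab P K K₀, cube K K₀ j ⊆ Ω → _ := fun j hj =>
      hcubeK P hdd hPL1 K hK1 hK hK₀M hN3 a msq le_rfl le_rfl hmsq hcap j A ec hec (hle.trans (min_le_left _ _))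
        (abs_acT_sub_le_of_reg_on hK hK₀M hK₀' C j A hec fun z hz μ ν => hreg z (hj hz) μ ν)
    have hdj : ∀ j : Lab P K K₀, cube K K₀ j ⊆ Ω → _ := fun j hj =>
      hderK P hdd hPL1 hK1 hK hK₀M hN3 hcap j A hec hle3 fun z hz μ' ν => hreg z (hj hz) μ' ν
    have hhj : ∀ j : Lab P K K₀, cube K K₀ j ⊆ Ω → _ := fun j hj =>
      hholK P hdd hPL1 hK1 hK hK₀M hN3 hcap A hec hle4 j fun z hz μ' ν => hreg z (hj hz) μ' ν
    -- the smallness `d²·c·e_K^β ≤ 1/3`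
    have hsmall : (P.d : ℝ) ^ 2 * creg * ec ^ β ≤ 1 / 3 := by
      have h1 : ec ^ β ≤ es ^ β := Real.rpow_le_rpow hec.le (hle.trans (min_le_right _ _)) hβ.le
      have h2 : es ^ β = (3 * ((P.d : ℝ) ^ 2 * creg + 1))⁻¹ := by rw [hes, Real.rpow_inv_rpow hin.le hβ.ne']
      rw [h2] at h1
      have h3 : (P.d : ℝ) ^ 2 * creg * ec ^ β ≤ (P.d : ℝ) ^ 2 * creg * (3 * ((P.d : ℝ) ^ 2 * creg + 1))⁻¹ :=
        mul_le_mul_of_nonneg_left h1 (by positivity)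
      refine h3.trans ?_
      rw [← div_eq_mul_inv, div_le_div_iff₀ (by positivity) (by norm_num)]
      nlinarith [sq_nonneg (P.d : ℝ), mul_nonneg (sq_nonneg (P.d : ℝ)) hcreg]
    have hreg' : ∀ z ∈ Ω, ∀ μ ν : Fin P.d,
        P.mesh K * |C.e| / ec * |A ⟨z.shift ν, μ⟩ - A ⟨z, μ⟩| ≤ creg * ec ^ (β - 1) / (P.L : ℝ) ^ K :=
      fun z hz μ ν => hreg z hz ν μ
    -- the `L²` letter at every piece
    have h2 : ∀ (j : Lab P K K₀) (ψ : HiggsLattice.ScalarField P 0 N), (∀ y, y ∉ Ω → ψ y = 0) →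
        sNorm (bOp C K K₀ Ω A msq a j ψ) ≤ βK * sNorm ψ := by
      intro j ψ hψ
      by_cases hj : cube K K₀ j ⊆ Ω
      · have h22 := (hcj j hj).2.2.1 2 2 (by norm_num) le_rfl (by rw [sub_self]; positivity) ψ
        have hc := cTwo_pos P K
        rw [lpT_two_eq, lpT_two_eq, mul_left_comm (Cβ / (K₀ : ℝ))] at h22
        have h3 := le_of_mul_le_mul_left h22 hc
        rw [bOp_of_good C Ω A msq a hj ψ, ← neg_one_smul ℝ, sNorm_smul, abs_neg, abs_one, one_mul]
        exact h3.trans (mul_le_mul_of_nonneg_right hCβK (sNorm_nonneg _))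
      · have hb := sNorm_bOp_le_of_bad C ha hL1 hmsq hK1 hK hK₀M hK₀8 hN3 hΩ A hec hreg' hsmall hj ψ hψ
        refine hb.trans (mul_le_mul_of_nonneg_right (le_trans (le_of_eq ?_) hCbK) (sNorm_nonneg _))
        rw [hCb, hγ₀, hPL, hdd]
    -- `R₀` around both points and the distance to `supp g`
    have hR : ∀ x'' ∈ ({x, x'} : Finset (HiggsLattice.Site P 0)), ∀ y,
        HiggsLattice.Site.tdist x'' y ≤ 2 * rS P K K₀ + 2 * half P K K₀ * (P.d + 1) → y ∈ Ω := by
      intro x'' hx'' y hy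
      simp only [Finset.mem_insert, Finset.mem_singleton] at hx''
      rcases hx'' with h | h
      · subst h; exact hRx y (by omega)
      · subst h; exact hRx' y (by omega)
    have hfX : ∀ x'' ∈ ({x, x'} : Finset (HiggsLattice.Site P 0)), ∀ y, g y ≠ 0 → ⌈D⌉₊ ≤ HiggsLattice.Site.tdist x'' y := by
      intro x'' hx'' y hy
      simp only [Finset.mem_insert, Finset.mem_singleton] at hx''
      rcases hx'' with h | h
      · subst h; exact Nat.ceil_le.2 (hDx y hy)
      · subst h; exact Nat.ceil_le.2 (hDx' y hy)
    -- casts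
    have hdd1 : ((dd P : ℝ) + 1) = (P.d : ℝ) := by
      rw [← dd_succ P]; push_cast; ring
    have hnR : ((((P.L - 1 + 1) ^ K : ℕ)) : ℝ) = (P.L : ℝ) ^ K := by
      rw [predL_succ, Nat.cast_pow]
    have hmeshK : P.mesh K = (P.L : ℝ) ^ K * P.mesh 0 := by
      unfold HiggsLattice.Params.mesh; ring
    have hγT := gammaT_le (Pd := P.d) (K₀ := K₀) (CH := CH) (α := α) hK₀8 hD1 hD2 hCδ.le hCγ'.le hn0 hmesh0 ht1 htn
      (Nat.cast_nonneg l.length) hlen hα1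
    have esub : ∀ a' b' c' d' : EuclideanSpace ℝ (Fin N), a' + b' - (c' + d') = (a' - c') + (b' - d') := fun _ _ _ _ => by abel
    -- the remainder for the Hölder probe
    have hC0 : 0 ≤ 2 * ((P.mesh 0)⁻¹ * (2 * ((Real.sqrt (P.mesh 0 ^ P.d))⁻¹ * msq⁻¹ * sNorm g))) := by
      have := Real.sqrt_nonneg (P.mesh 0 ^ P.d)
      have := sNorm_nonneg g
      positivity
    have hrem : ∀ ε' : ℝ, 0 < ε' → ∃ m : ℕ,
        ‖hol C A x l (covDeriv C A ((GP C K Ω A msq a * RopP C K K₀ Ω A msq a ^ m) g) ⟨x', μ⟩)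
          - covDeriv C A ((GP C K Ω A msq a * RopP C K K₀ Ω A msq a ^ m) g) ⟨x, μ⟩‖ ≤ ε' :=
      exists_le_of_geometric (Φ := fun m => ‖hol C A x l (covDeriv C A ((GP C K Ω A msq a * RopP C K K₀ Ω A msq a ^ m) g) ⟨x', μ⟩)
          - covDeriv C A ((GP C K Ω A msq a * RopP C K K₀ Ω A msq a ^ m) g) ⟨x, μ⟩‖)
        (by positivity) h23 hC0 fun m => by
          refine (norm_sub_le _ _).trans ?_
          rw [norm_hol_apply]
          have h1 := norm_covDeriv_tail_le C Ω A hK hK₀M hK₀8 hmsq hak hβK0 h2 m g ⟨x', μ⟩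
          have h2' := norm_covDeriv_tail_le C Ω A hK hK₀M hK₀8 hmsq hak hβK0 h2 m g ⟨x, μ⟩
          linarith
    -- the chain with the Hölder probe
    have hmain := chain_region_of_inputs_probe C Ω A hK hK₀M hK₀8 hN3 hΩ hmsq hak (n₀ := P.d) P.hd
      (γ := Cnear * (t / (P.L : ℝ) ^ K) ^ α * P.mesh K) (β := βK) (by positivity) hβK0 hDβ
      (Φ := fun w => ‖hol C A x l (covDeriv C A w ⟨x', μ⟩) - covDeriv C A w ⟨x, μ⟩‖)
      (by rw [covDeriv_zero', covDeriv_zero', map_zero, sub_zero, norm_zero])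
      (fun u v => by
        show ‖hol C A x l (covDeriv C A (u + v) ⟨x', μ⟩) - covDeriv C A (u + v) ⟨x, μ⟩‖ ≤ _
        rw [covDeriv_add', covDeriv_add', map_add, esub]
        exact norm_add_le _ _)
      ({x, x'} : Finset (HiggsLattice.Site P 0))
      (fun i hi g' => by
        have hx1 : ¬ Near K K₀ (rS P K K₀) i x := hi x (by simp)
        have hx2 : ¬ Near K K₀ (rS P K K₀) i x' := hi x' (by simp)
        show ‖hol C A x l (covDeriv C A (aOp C K K₀ Ω A msq a i g') ⟨x', μ⟩) - covDeriv C A (aOp C K K₀ Ω A msq a i g') ⟨x, μ⟩‖ ≤ 0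
        rw [aOp_apply, covDeriv_hsmul_eq_zero_off C hK hK₀M hK₀8 i A _ (b := ⟨x', μ⟩) hx2,
          covDeriv_hsmul_eq_zero_off C hK hK₀M hK₀8 i A _ (b := ⟨x, μ⟩) hx1, map_zero, sub_zero, norm_zero])
      (fun i hi g' => by
        show ‖hol C A x l (covDeriv C A (aOp C K K₀ Ω A msq a i g') ⟨x', μ⟩) - covDeriv C A (aOp C K K₀ Ω A msq a i g') ⟨x, μ⟩‖
          ≤ Cnear * (t / (P.L : ℝ) ^ K) ^ α * P.mesh K * ‖g'‖
        rw [aOp_apply, Gloc_of_good C Ω A msq a hi]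
        have hg' := norm_nonneg g'
        have hP := norm_probe_hsmul_le C hK hK₀M hK₀8 hN3 hroom i A
          (propagatorK C (cube K K₀ i) (cubeVec K K₀ i A) msq a K (hTor K K₀ i • g'))
          (γ0 := Cγ' * P.mesh K ^ 2 * ‖g'‖) (γD := Cδ * P.mesh K * ‖g'‖) (γH := CH * (t / (P.L : ℝ) ^ K) ^ α * P.mesh K * ‖g'‖)
          (by positivity) (by positivity) (by positivity) μ hch hend hlen hnt
          (fun y => (norm_le_pi_norm _ y).trans ((hdj i hi).1 g')) (fun y ν hy hs => (hdj i hi).2.1 g' y ν hy hs)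
          (fun h1 h2 h3 h4 h5 => hhj i hi g' μ x x' l h1 h2 h3 h4 hne hch hend h5 hlen)
        refine hP.trans ?_
        rw [hdd1, hnR, hmeshK]
        have e1 : CH * (t / (P.L : ℝ) ^ K) ^ α * ((P.L : ℝ) ^ K * P.mesh 0) * ‖g'‖
            + (P.d : ℝ) * (D1 hprof + D2 hprof) / K₀ * ((2 * l.length + 2) / (P.L : ℝ) ^ K) * (Cδ * ((P.L : ℝ) ^ K * P.mesh 0) * ‖g'‖)
            + (D1 hprof ^ 2 + D2 hprof) / (K₀ : ℝ) ^ 2 * ((P.d : ℝ) * l.length / (((P.L : ℝ) ^ K) ^ 2 * P.mesh 0))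
              * (Cγ' * ((P.L : ℝ) ^ K * P.mesh 0) ^ 2 * ‖g'‖)
            = (CH * (t / (P.L : ℝ) ^ K) ^ α * ((P.L : ℝ) ^ K * P.mesh 0)
              + (P.d : ℝ) * (D1 hprof + D2 hprof) / K₀ * ((2 * l.length + 2) / (P.L : ℝ) ^ K) * (Cδ * ((P.L : ℝ) ^ K * P.mesh 0))
              + (D1 hprof ^ 2 + D2 hprof) / (K₀ : ℝ) ^ 2 * ((P.d : ℝ) * l.length / (((P.L : ℝ) ^ K) ^ 2 * P.mesh 0))
                * (Cγ' * ((P.L : ℝ) ^ K * P.mesh 0) ^ 2)) * ‖g'‖ := by ring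
        rw [e1]
        calc _ ≤ (Cnear * (t / (P.L : ℝ) ^ K) ^ α * ((P.L : ℝ) ^ K * P.mesh 0)) * ‖g'‖ := by
              rw [hCnear]; exact mul_le_mul_of_nonneg_right hγT hg'
          _ = _ := by ring)
      (fun j hj ψ => by
        rw [bOp_of_good C Ω A msq a hj ψ, norm_neg]
        exact ((hcj j hj).2.1 ψ).trans (mul_le_mul_of_nonneg_right hCβK (norm_nonneg _)))
      (fun j hj p q h1p hpq hdiff ψ => by
        rw [bOp_of_good C Ω A msq a hj ψ, lpT_neg]
        exact ((hcj j hj).2.2.1 p q h1p hpq hdiff ψ).trans (mul_le_mul_of_nonneg_right hCβK (lpT_nonneg _ _)))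
      (fun j hj ψ => by
        rw [bOp_of_good C Ω A msq a hj ψ, norm_neg]
        exact ((hcj j hj).2.2.2 (2 * P.d) le_rfl ψ).trans (mul_le_mul_of_nonneg_right hCβK (lpT_nonneg _ _)))
      h2 hR g (Dist := ⌈D⌉₊) hfX (V := 1) le_rfl
      (by rw [one_mul]; exact lpT_two_le_of_blockK hK y₀ hg) hrem
    -- the exponent `(⌈D⌉ − 4rS)/(2M) ≥ D/(2K₀L^K) − 3/2`
    have hh : (half P K K₀ : ℝ) = (P.L : ℝ) ^ K * K₀ := by unfold half; push_cast; ring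
    have hhpos : (0 : ℝ) < half P K K₀ := by exact_mod_cast half_pos hK₀'
    have hrS := rS_le_real (P := P) (K := K) hK₀8
    have hexp : Real.exp (-(((⌈D⌉₊ : ℝ) - 4 * rS P K K₀) / (2 * half P K K₀)))
        ≤ Real.exp (3 / 2) * Real.exp (-(D / (2 * K₀ * (P.L : ℝ) ^ K))) := by
      rw [← Real.exp_add]
      refine Real.exp_le_exp.2 ?_
      have hDc : D ≤ (⌈D⌉₊ : ℝ) := Nat.le_ceil D
      have e1 : D / (2 * K₀ * (P.L : ℝ) ^ K) = D / (2 * half P K K₀) := by rw [hh]; ring_nf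
      rw [e1]
      have h4 : (4 * (rS P K K₀ : ℝ)) ≤ 3 * half P K K₀ := by linarith
      have h5 : -(3 / 2 : ℝ) ≤ ((⌈D⌉₊ : ℝ) - D - 4 * rS P K K₀) / (2 * half P K K₀) := by
        rw [le_div_iff₀ (by positivity)]
        linarith
      have e2 : ((⌈D⌉₊ : ℝ) - 4 * rS P K K₀) / (2 * half P K K₀) - D / (2 * half P K K₀)
          = ((⌈D⌉₊ : ℝ) - D - 4 * rS P K K₀) / (2 * half P K K₀) := by ring
      linarith
    have hcard : (({x, x'} : Finset (HiggsLattice.Site P 0)).card : ℝ) ≤ 2 := by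
      exact_mod_cast (Finset.card_insert_le _ _).trans (by rw [Finset.card_singleton])
    have hw : ((t / (P.L : ℝ) ^ K)⁻¹) ^ α * (t / (P.L : ℝ) ^ K) ^ α = 1 := by
      rw [Real.inv_rpow hq0.le, inv_mul_cancel₀ (Real.rpow_pos_of_pos hq0 α).ne']
    have hQ : Q ≤ 4 * 2 ^ P.d * (Cnear * (t / (P.L : ℝ) ^ K) ^ α * P.mesh K) * (Real.exp (3 / 2)
        * Real.exp (-(D / (2 * K₀ * (P.L : ℝ) ^ K)))) * M := by
      refine hmain.trans ?_
      calc 2 * ((({x, x'} : Finset (HiggsLattice.Site P 0)).card : ℝ) * 2 ^ P.d) * (Cnear * (t / (P.L : ℝ) ^ K) ^ α * P.mesh K) * 1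
            * Real.exp (-(((⌈D⌉₊ : ℝ) - 4 * rS P K K₀) / (2 * half P K K₀))) * ‖g‖
          ≤ 2 * (2 * 2 ^ P.d) * (Cnear * (t / (P.L : ℝ) ^ K) ^ α * P.mesh K) * 1
            * (Real.exp (3 / 2) * Real.exp (-(D / (2 * K₀ * (P.L : ℝ) ^ K)))) * M := by
            refine mul_le_mul (mul_le_mul ?_ hexp (by positivity) (by positivity)) hgn (norm_nonneg _) (by positivity)
            have h1 : (({x, x'} : Finset (HiggsLattice.Site P 0)).card : ℝ) * 2 ^ P.d ≤ 2 * 2 ^ P.d :=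
              mul_le_mul_of_nonneg_right hcard (by positivity)
            have h2 : 2 * ((({x, x'} : Finset (HiggsLattice.Site P 0)).card : ℝ) * 2 ^ P.d) ≤ 2 * (2 * 2 ^ P.d) :=
              mul_le_mul_of_nonneg_left h1 (by norm_num)
            exact mul_le_mul_of_nonneg_right (mul_le_mul_of_nonneg_right h2 (by positivity)) zero_le_one
        _ = _ := by ring
    calc ((t / (P.L : ℝ) ^ K)⁻¹) ^ α * Q
        ≤ ((t / (P.L : ℝ) ^ K)⁻¹) ^ α * (4 * 2 ^ P.d * (Cnear * (t / (P.L : ℝ) ^ K) ^ α * P.mesh K) * (Real.exp (3 / 2)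
            * Real.exp (-(D / (2 * K₀ * (P.L : ℝ) ^ K)))) * M) :=
          mul_le_mul_of_nonneg_left hQ (Real.rpow_nonneg (inv_nonneg.2 hq0.le) α)
      _ = (((t / (P.L : ℝ) ^ K)⁻¹) ^ α * (t / (P.L : ℝ) ^ K) ^ α) * (4 * 2 ^ P.d * Cnear * Real.exp (3 / 2) * P.mesh K
            * Real.exp (-(D / (2 * K₀ * (P.L : ℝ) ^ K))) * M) := by ring
      _ = 4 * 2 ^ P.d * Cnear * Real.exp (3 / 2) * P.mesh K * Real.exp (-(D / (2 * K₀ * (P.L : ℝ) ^ K))) * M := by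
          rw [hw, one_mul]
      _ ≤ (4 * 2 ^ P.d * Cnear * Real.exp (3 / 2) + 2 * c₉) * P.mesh K * Real.exp (-(D / (2 * K₀ * (P.L : ℝ) ^ K))) * M := by
          have hle1 : 4 * 2 ^ P.d * Cnear * Real.exp (3 / 2) ≤ 4 * 2 ^ P.d * Cnear * Real.exp (3 / 2) + 2 * c₉ := by linarith
          exact mul_le_mul_of_nonneg_right (mul_le_mul_of_nonneg_right (mul_le_mul_of_nonneg_right hle1 hmesh.le) hE0) hM0
  · -- the regime `|x − x′| > L^K`: «a simple consequence of the corresponding inequality for the derivative only» — the derivative member at both bonds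
    have htn : (P.L : ℝ) ^ K < t := by
      rw [ht_def]; exact_mod_cast (not_le.1 hnt)
    have hw1 : ((t / (P.L : ℝ) ^ K)⁻¹) ^ α ≤ 1 :=
      Real.rpow_le_one (inv_nonneg.2 hq0.le) (inv_le_one_of_one_le₀ ((one_le_div hn0).2 htn.le)) hα0
    have h1 := hfar' x' hRx' hDx'
    have h2 := hfar' x hRx hDx
    have hQ : Q ≤ 2 * c₉ * P.mesh K * Real.exp (-(D / (2 * K₀ * (P.L : ℝ) ^ K))) * M := by
      refine (norm_sub_le _ _).trans ?_
      rw [norm_hol_apply]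
      linarith
    calc ((t / (P.L : ℝ) ^ K)⁻¹) ^ α * Q ≤ 1 * Q := mul_le_mul_of_nonneg_right hw1 hQ0
      _ ≤ 2 * c₉ * P.mesh K * Real.exp (-(D / (2 * K₀ * (P.L : ℝ) ^ K))) * M := by rw [one_mul]; exact hQ
      _ ≤ (4 * 2 ^ P.d * Cnear * Real.exp (3 / 2) + 2 * c₉) * P.mesh K * Real.exp (-(D / (2 * K₀ * (P.L : ℝ) ^ K))) * M := by
          have hle2 : 2 * c₉ ≤ 4 * 2 ^ P.d * Cnear * Real.exp (3 / 2) + 2 * c₉ := by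
            have : 0 ≤ 4 * 2 ^ P.d * Cnear * Real.exp (3 / 2) := by positivity
            linarith
          exact mul_le_mul_of_nonneg_right (mul_le_mul_of_nonneg_right (mul_le_mul_of_nonneg_right hle2 hmesh.le) hE0) hM0

end Main


/-! ## §4 Summation over the `K`-blocks: arbitrary `g` -/

section Sum

variable {K : ℕ}

set_option maxHeartbeats 1600000 in
/-- **PROP. 2.1 (2.24) FOR BIG-BLOCK REGIONS UNDER `R₀` AT EVERY (2.23)-REGULAR FIELD, ARBITRARY `g`** — B4's THEOREM (1.9) FOR REGIONS ON THE
CARRIER in the operator form of gens 10–11: same data as `norm_holder_propagatorK_region_reg_decay`; `K₀min` before `α`, then for every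
`0 ≤ α < 1` and `K₀ ≥ K₀min` constants `c₀(K₀), e₁(K₀) > 0` such that … for EVERY `g` with `‖g‖_∞ ≤ M′` vanishing within `D` of `x` and of `x′`:
`(|x − x′|/L^K)^{−α}·‖U(A(Γ))(D^ε_AG^ε_K(Ω,A)1_Ωg)(⟨x′,μ⟩) − (D^ε_AG^ε_K(Ω,A)1_Ωg)(⟨x,μ⟩)‖ ≤ c₀(K₀)(L^Kε)·exp(−D/(4K₀L^K))·M′`.  Proof:
`g = Σ_b g|_{B^K(b)}` over the sites of `T^{(K)}`, the Hölder probe is subadditive, each piece is within the previous theorem with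
`D_b = max(D, L^K(min(|x_K − b|, |x′_K − b|) − 1))`, and `Σ_b (e^{−|x_K − b|/(4K₀)} + e^{−|x′_K − b|/(4K₀)}) ≤ 2K_d(1/(4K₀))`.
[cite: Balaban1982Higgs1, Prop. 2.1 (2.23)–(2.24) p.610] [cite: Balaban1983RegularityDecay, Theorem (1.9) p.573; (2.21)–(2.22) pp.578–579] -/
theorem norm_holder_propagatorK_region_reg_decay_sum (d L : ℕ) (hd : 1 ≤ d) (hL : 2 ≤ L) {a : ℝ} (ha : 0 < a) {msq : ℝ}
    (hmsq : 0 < msq) (N : ℕ) (C : ChargeData N) (ε₀ : ℝ) (creg β : ℝ) (hcreg : 0 ≤ creg) (hβ : 0 < β) :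
    ∃ K₀min : ℕ, ∀ {α : ℝ}, 0 ≤ α → α < 1 → ∀ K₀ : ℕ, K₀min ≤ K₀ → ∃ c₀ e₁ : ℝ, 0 < c₀ ∧ 0 < e₁ ∧
      ∀ (P : HiggsLattice.Params), P.d = d → P.L = L → K₀ ∣ P.M →
      ∀ {K : ℕ}, 1 ≤ K → K ≤ P.K → (∀ μ, 3 * half P K K₀ ≤ P.sitesPerDir 0 μ) → P.mesh K ≤ ε₀ →
      ∀ (Ω : Finset (HiggsLattice.Site P 0)), IsBigBlockUnion K K₀ Ω →
      ∀ (A : HiggsLattice.VecField P 0) {ec : ℝ}, 0 < ec → ec ≤ e₁ →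
      (∀ z ∈ Ω, ∀ μ ν : Fin P.d,
          P.mesh K * |C.e| / ec * |A ⟨z.shift μ, ν⟩ - A ⟨z, ν⟩| ≤ creg * ec ^ (β - 1) / (P.L : ℝ) ^ K) →
      ∀ (μ : Fin P.d) (x x' : HiggsLattice.Site P 0), x' ≠ x →
        (∀ y, HiggsLattice.Site.tdist x y ≤ 2 * rS P K K₀ + 2 * half P K K₀ * (P.d + 1) + 1 → y ∈ Ω) →
        (∀ y, HiggsLattice.Site.tdist x' y ≤ 2 * rS P K K₀ + 2 * half P K K₀ * (P.d + 1) + 1 → y ∈ Ω) →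
        ∀ (l : List (HiggsLattice.Site P 0)), IsTChain x l → pathEnd x l = x' →
          (l.length : ℝ) ≤ (P.d : ℝ) * HiggsLattice.Site.tdist x x' →
        ∀ (g : HiggsLattice.ScalarField P 0 N) (M D : ℝ), (∀ y, ‖g y‖ ≤ M) → 0 ≤ D →
          (∀ z, g z ≠ 0 → D ≤ (HiggsLattice.Site.tdist x z : ℝ)) → (∀ z, g z ≠ 0 → D ≤ (HiggsLattice.Site.tdist x' z : ℝ)) →
            (((HiggsLattice.Site.tdist x x' : ℝ) / (P.L : ℝ) ^ K)⁻¹) ^ α *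
                ‖hol C A x l (covDeriv C A (propagatorK C Ω A msq a K (chi Ω • g)) ⟨x', μ⟩)
                  - covDeriv C A (propagatorK C Ω A msq a K (chi Ω • g)) ⟨x, μ⟩‖
              ≤ c₀ * P.mesh K * Real.exp (-(D / (4 * K₀ * (P.L : ℝ) ^ K))) * M := by
  obtain ⟨K₀min, hmain⟩ := norm_holder_propagatorK_region_reg_decay d L hd hL ha hmsq N C ε₀ creg β hcreg hβ
  refine ⟨max K₀min 1, fun {α} hα0 hα1 K₀ hK₀ => ?_⟩
  obtain ⟨c₀, hc₀, hmainα⟩ := hmain hα0 hα1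
  have hK₀1 : 1 ≤ K₀ := le_trans (le_max_right _ _) hK₀
  have hK₀r : (0 : ℝ) < K₀ := by exact_mod_cast hK₀1
  obtain ⟨e₁, he₁, hblk⟩ := hmainα K₀ (le_trans (le_max_left _ _) hK₀)
  have hrate : (0 : ℝ) < 1 / (4 * K₀) := by positivity
  have hlc : 0 < latticeConst d (1 / (4 * K₀)) := by
    unfold latticeConst
    apply pow_pos
    have hdr : (0 : ℝ) < d := by exact_mod_cast hd
    have h1 : Real.exp (-(1 / (4 * (K₀ : ℝ)) / d)) < 1 := Real.exp_lt_one_iff.2 (by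
      have := div_pos hrate hdr; linarith)
    have h2 : 0 < 1 - Real.exp (-(1 / (4 * (K₀ : ℝ)) / d)) := by linarith
    positivity
  refine ⟨c₀ * Real.exp (1 / (4 * K₀)) * (2 * latticeConst d (1 / (4 * K₀))), e₁, by positivity, he₁, ?_⟩
  intro P hPd hPL hK₀M K hK1 hK hN3 hε Ω hΩ A ec hec hle hreg μ x x' hne hRx hRx' l hch hend hlen g M D hgM hD0 hDx hDx'
  subst hPd
  have hmK0 : 0 < P.mesh K := P.mesh_pos K
  have hM0 : 0 ≤ M := (norm_nonneg _).trans (hgM x)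
  have hLK : (0 : ℝ) < (P.L : ℝ) ^ K := pow_pos (by exact_mod_cast P.hL) K
  set w : ℝ := (((HiggsLattice.Site.tdist x x' : ℝ) / (P.L : ℝ) ^ K)⁻¹) ^ α with hw_def
  have hw0 : 0 ≤ w := Real.rpow_nonneg (inv_nonneg.2 (div_nonneg (Nat.cast_nonneg _) hLK.le)) α
  -- split `g` over the `K`-blocks; the probe is subadditive
  have esub : ∀ (s : Finset (HiggsLattice.Site P K)) (u : HiggsLattice.Site P K → HiggsLattice.ScalarField P 0 N),
      ‖hol C A x l (covDeriv C A (∑ b ∈ s, u b) ⟨x', μ⟩) - covDeriv C A (∑ b ∈ s, u b) ⟨x, μ⟩‖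
        ≤ ∑ b ∈ s, ‖hol C A x l (covDeriv C A (u b) ⟨x', μ⟩) - covDeriv C A (u b) ⟨x, μ⟩‖ := by
    intro s u
    rw [covDeriv_sum', covDeriv_sum', map_sum, ← Finset.sum_sub_distrib]
    exact norm_sum_le _ _
  have hsplit : ‖hol C A x l (covDeriv C A (propagatorK C Ω A msq a K (chi Ω • g)) ⟨x', μ⟩)
        - covDeriv C A (propagatorK C Ω A msq a K (chi Ω • g)) ⟨x, μ⟩‖
      ≤ ∑ b : HiggsLattice.Site P K, ‖hol C A x l (covDeriv C A (propagatorK C Ω A msq a K (chi Ω • blockPiece K b g)) ⟨x', μ⟩)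
        - covDeriv C A (propagatorK C Ω A msq a K (chi Ω • blockPiece K b g)) ⟨x, μ⟩‖ := by
    have e : propagatorK C Ω A msq a K (chi Ω • g)
        = ∑ b : HiggsLattice.Site P K, propagatorK C Ω A msq a K (chi Ω • blockPiece K b g) := by
      conv_lhs => rw [← sum_blockPiece (K := K) g]
      rw [Finset.smul_sum, map_sum]
    rw [e]
    exact esub _ _
  -- each block piece: the previous theorem with `D_b = max D (L^K(min(|x_K − b|, |x′_K − b|) − 1))`
  have hpiece : ∀ b : HiggsLattice.Site P K,
      w * ‖hol C A x l (covDeriv C A (propagatorK C Ω A msq a K (chi Ω • blockPiece K b g)) ⟨x', μ⟩)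
        - covDeriv C A (propagatorK C Ω A msq a K (chi Ω • blockPiece K b g)) ⟨x, μ⟩‖
        ≤ c₀ * P.mesh K * (Real.exp (-(D / (4 * K₀ * (P.L : ℝ) ^ K))) * Real.exp (1 / (4 * K₀))
            * (Real.exp (-(1 / (4 * K₀) * (HiggsLattice.Site.tdist (blockIter K x) b : ℝ)))
              + Real.exp (-(1 / (4 * K₀) * (HiggsLattice.Site.tdist (blockIter K x') b : ℝ))))) * M := by
    intro b
    classical
    by_cases hb : ∃ y₀, blockIter K y₀ = b
    · obtain ⟨y₀, hy₀⟩ := hb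
      set tm : ℝ := min (HiggsLattice.Site.tdist (blockIter K x) b : ℝ) (HiggsLattice.Site.tdist (blockIter K x') b : ℝ) with htm
      set Db : ℝ := max D ((P.L : ℝ) ^ K * (tm - 1)) with hDb
      have hDb0 : 0 ≤ Db := hD0.trans (le_max_left _ _)
      have hfarz : ∀ z₀ : HiggsLattice.Site P 0, tm ≤ (HiggsLattice.Site.tdist (blockIter K z₀) b : ℝ) →
          (∀ z, g z ≠ 0 → D ≤ (HiggsLattice.Site.tdist z₀ z : ℝ)) →
          ∀ z, blockPiece K b g z ≠ 0 → Db ≤ (HiggsLattice.Site.tdist z₀ z : ℝ) := by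
        intro z₀ htm' hDz z hz
        have hzb : blockIter K z = b := by
          by_contra h
          exact hz (by unfold blockPiece; rw [if_neg h])
        have hgz : g z ≠ 0 := fun h0 => hz (by unfold blockPiece; rw [if_pos hzb, h0])
        refine max_le (hDz z hgz) ?_
        have h1 := tdist_blockIter_le_real hK z₀ z
        rw [hzb] at h1
        have h2 : (P.L : ℝ) ^ K * (HiggsLattice.Site.tdist (blockIter K z₀) b : ℝ)
            ≤ (P.L : ℝ) ^ K * ((HiggsLattice.Site.tdist z₀ z : ℝ) / (P.L : ℝ) ^ K + 1 - ((P.L : ℝ) ^ K)⁻¹) :=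
          mul_le_mul_of_nonneg_left h1 hLK.le
        have e : (P.L : ℝ) ^ K * ((HiggsLattice.Site.tdist z₀ z : ℝ) / (P.L : ℝ) ^ K + 1 - ((P.L : ℝ) ^ K)⁻¹)
            = (HiggsLattice.Site.tdist z₀ z : ℝ) + (P.L : ℝ) ^ K - 1 := by field_simp
        rw [e] at h2
        have h3 : (P.L : ℝ) ^ K * (tm - 1) ≤ (P.L : ℝ) ^ K * ((HiggsLattice.Site.tdist (blockIter K z₀) b : ℝ) - 1) :=
          mul_le_mul_of_nonneg_left (by linarith) hLK.le
        rw [mul_sub, mul_one] at h3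
        linarith
      have h := hblk P rfl hPL hK₀M hK1 hK hN3 hε Ω hΩ A hec hle hreg μ x x' hne hRx hRx' l hch hend hlen y₀ (blockPiece K b g) M Db
        (blockPiece_supported b g hy₀) (fun y => (norm_blockPiece_apply_le b g y).trans (hgM y)) hDb0
        (hfarz x (min_le_left _ _) hDx) (hfarz x' (min_le_right _ _) hDx')
      refine h.trans (mul_le_mul_of_nonneg_right (mul_le_mul_of_nonneg_left ?_ (by positivity)) hM0)
      -- `e^{−D_b/(2K₀L^K)} ≤ e^{−D/(4K₀L^K)}·e^{1/(4K₀)}·(e^{−|x_K − b|/(4K₀)} + e^{−|x′_K − b|/(4K₀)})`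
      have hK4 : (0 : ℝ) < 4 * K₀ * (P.L : ℝ) ^ K := by positivity
      have hmax : D + (P.L : ℝ) ^ K * (tm - 1) ≤ 2 * Db := by rw [two_mul]; exact add_le_add (le_max_left _ _) (le_max_right _ _)
      have key : (D + (P.L : ℝ) ^ K * (tm - 1)) / (4 * K₀ * (P.L : ℝ) ^ K) ≤ Db / (2 * K₀ * (P.L : ℝ) ^ K) :=
        calc (D + (P.L : ℝ) ^ K * (tm - 1)) / (4 * K₀ * (P.L : ℝ) ^ K)
            ≤ 2 * Db / (4 * K₀ * (P.L : ℝ) ^ K) := div_le_div_of_nonneg_right hmax hK4.le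
          _ = Db / (2 * K₀ * (P.L : ℝ) ^ K) := by field_simp; ring
      have e1 : (D + (P.L : ℝ) ^ K * (tm - 1)) / (4 * K₀ * (P.L : ℝ) ^ K)
          = D / (4 * K₀ * (P.L : ℝ) ^ K) - 1 / (4 * K₀) + 1 / (4 * K₀) * tm := by
        field_simp
        ring
      rw [e1] at key
      have hstep : Real.exp (-(Db / (2 * K₀ * (P.L : ℝ) ^ K)))
          ≤ Real.exp (-(D / (4 * K₀ * (P.L : ℝ) ^ K))) * Real.exp (1 / (4 * K₀)) * Real.exp (-(1 / (4 * K₀) * tm)) := by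
        rw [← Real.exp_add, ← Real.exp_add]
        exact Real.exp_le_exp.2 (by linarith)
      refine hstep.trans (mul_le_mul_of_nonneg_left ?_ (by positivity))
      rcases min_choice (HiggsLattice.Site.tdist (blockIter K x) b : ℝ) (HiggsLattice.Site.tdist (blockIter K x') b : ℝ) with h | h
      · rw [htm, h]; exact le_add_of_nonneg_right (Real.exp_pos _).le
      · rw [htm, h]; exact le_add_of_nonneg_left (Real.exp_pos _).le
    · -- no site maps to `b`: the piece vanishes
      have h0 : blockPiece K b g = 0 := by
        funext y
        unfold blockPiece
        rw [if_neg (fun h => hb ⟨y, h⟩)]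
        rfl
      rw [h0, smul_zero, map_zero, covDeriv_zero', covDeriv_zero', map_zero, sub_zero, norm_zero, mul_zero]
      positivity
  have hsumx := sum_exp_neg_tdist_le (P := P) (k := K) hrate (blockIter K x)
  have hsumx' := sum_exp_neg_tdist_le (P := P) (k := K) hrate (blockIter K x')
  calc w * ‖hol C A x l (covDeriv C A (propagatorK C Ω A msq a K (chi Ω • g)) ⟨x', μ⟩)
        - covDeriv C A (propagatorK C Ω A msq a K (chi Ω • g)) ⟨x, μ⟩‖
      ≤ w * ∑ b : HiggsLattice.Site P K, ‖hol C A x l (covDeriv C A (propagatorK C Ω A msq a K (chi Ω • blockPiece K b g)) ⟨x', μ⟩)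
        - covDeriv C A (propagatorK C Ω A msq a K (chi Ω • blockPiece K b g)) ⟨x, μ⟩‖ := mul_le_mul_of_nonneg_left hsplit hw0
    _ = ∑ b : HiggsLattice.Site P K, w * ‖hol C A x l (covDeriv C A (propagatorK C Ω A msq a K (chi Ω • blockPiece K b g)) ⟨x', μ⟩)
        - covDeriv C A (propagatorK C Ω A msq a K (chi Ω • blockPiece K b g)) ⟨x, μ⟩‖ := by rw [Finset.mul_sum]
    _ ≤ ∑ b : HiggsLattice.Site P K, c₀ * P.mesh K * (Real.exp (-(D / (4 * K₀ * (P.L : ℝ) ^ K))) * Real.exp (1 / (4 * K₀))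
            * (Real.exp (-(1 / (4 * K₀) * (HiggsLattice.Site.tdist (blockIter K x) b : ℝ)))
              + Real.exp (-(1 / (4 * K₀) * (HiggsLattice.Site.tdist (blockIter K x') b : ℝ))))) * M :=
        Finset.sum_le_sum fun b _ => hpiece b
    _ = c₀ * P.mesh K * (Real.exp (-(D / (4 * K₀ * (P.L : ℝ) ^ K))) * Real.exp (1 / (4 * K₀))
            * (∑ b : HiggsLattice.Site P K, Real.exp (-(1 / (4 * K₀) * (HiggsLattice.Site.tdist (blockIter K x) b : ℝ)))
              + ∑ b : HiggsLattice.Site P K, Real.exp (-(1 / (4 * K₀) * (HiggsLattice.Site.tdist (blockIter K x') b : ℝ))))) * M := by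
        rw [← Finset.sum_mul, ← Finset.mul_sum, ← Finset.mul_sum, Finset.sum_add_distrib]
    _ ≤ c₀ * P.mesh K * (Real.exp (-(D / (4 * K₀ * (P.L : ℝ) ^ K))) * Real.exp (1 / (4 * K₀))
            * (2 * latticeConst P.d (1 / (4 * K₀)))) * M :=
        mul_le_mul_of_nonneg_right (mul_le_mul_of_nonneg_left (mul_le_mul_of_nonneg_left (by linarith) (by positivity))
          (by positivity)) hM0
    _ = c₀ * Real.exp (1 / (4 * K₀)) * (2 * latticeConst P.d (1 / (4 * K₀))) * P.mesh K
            * Real.exp (-(D / (4 * K₀ * (P.L : ℝ) ^ K))) * M := by ring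

end Sum

end Literature.MathematicalPhysics.QuantumFieldTheory.Balaban1983to89.B1Ineq224RegularRegion

end
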